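import Literature.NumberTheory.EllipticCurves.FormalInvariantDerivation
import Literature.NumberTheory.EllipticCurves.FormalGroupNegProofs
import HarnessLib

/-!
# The invariant differential is invariant under the formal group law:
# `η(z₁) · ∂F/∂z₁ = η(F(z₁, z₂))` over any domain (Silverman AEC III.5.1 / IV.4, proofs only)

Trunk T-NT-EC (Literature/NumberTheory/EllipticCurves). Written for the discharge of the named fact
`WeierstrassCurve.padicLogPoint_add` (AEC VII.2.2 + IV.6.4(a): `log_W z(P + Q) = log_W z(P) +
log_W z(Q)` on `E₁(ℚ_p)`), whose formal heart (AEC IV.5.2, `log F(T, S) = log T + log S`) is the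
invariance of the differential `ω = dx/(2y + a₁x + a₃) = dz/η(z)` under the chord–tangent law
`F = formalGroupLaw W` of `FormalGroupLaw.lean`:

  **`ω(F(z₁, z₂)) · ∂F/∂zᵢ = ω(zᵢ)`**, equivalently (with `η = ω⁻¹ = 1 - f_w(z, w(z))` of
  `FormalInvariantDerivation.lean`) `η(zᵢ) · ∂ᵢF = η(F)` — `formalEta_subst_X_mul_pderiv_formalGroupLaw`.

Silverman obtains this from the ASSOCIATIVITY of `F` (IV.4.2: `ω_F = F_X(0,T)⁻¹ dT` is invariant by
differentiating `F(U, F(T, S)) = F(F(U, T), S)`), and identifies `ω_F` with the curve's `ω` through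
III.5.1 (`τ_Q^* ω = ω`), whose direct proof ("write `x(P + Q)` … in terms of `x(P), x(Q), y(P), y(Q)`
… a straightforward, but messy and unenlightening, calculation") is left to the reader. This file
does NOT use associativity (which the tree has only at points / over `ℚ_p` for elliptic curves,
`FormalGroupLawAxiomsProofs.lean`): it carries out the direct computation of III.5.1, organised as
Abel's argument for the moving chord in the `(z, w)`-plane of AEC IV.1, and therefore holds for EVERY
Weierstrass curve over an integral domain `R` (no `Δ ≠ 0`, no characteristic or integrality
hypothesis). With `f(z, w) = z³ + a₁zw + a₂z²w + a₃w² + a₄zw² + a₆w³` (AEC IV.1.1), `G = f - w`,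
`Γ = ∂G/∂w = f_w - 1` (so `η(z) = -Γ(z, w(z))`), chord `w = λz + ν` (`formalSlope`, `formalIntercept`),
`D = 1 + a₂λ + a₄λ² + a₆λ³`, `N = a₁λ + a₂ν + a₃λ² + 2a₄λν + 3a₆λ²ν`, `z₃ = formalChordZ = -z₁ - z₂ - N/D`:

* `formalChord_vieta` — **Vieta, formally**: `G(Z, λZ + ν) = D (Z - z₁)(Z - z₂)(Z - z₃)` for every
  `Z ∈ R⟦z₁, z₂⟧` (AEC IV.1 p. 117: "substituting `w = λz + ν` … gives a cubic in `z`, two of whose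
  roots are `z₁` and `z₂` … the third root is `z₃`"): the difference is linear in `Z` and vanishes at
  `z₁ ≠ z₂`. Hence the third point `(z₃, w₃ = λz₃ + ν)` lies on the cubic and `w₃ = w(z₃)`
  (`formalW_subst_formalChordZ`, uniqueness of the fixed point).
* `abel_relation` — for ANY `R`-derivation `δ` of `R⟦z₁, z₂⟧` (`R` a domain):
  `Γ₂Γ₃ δz₁ + Γ₁Γ₃ δz₂ + Γ₁Γ₂ δz₃ = 0` (`Γᵢ = Γ` at the three collinear points), i.e.
  `Σᵢ δzᵢ/Γᵢ = 0` — Abel's theorem for the pencil of lines: differentiate `G(ζᵢ, λζᵢ + ν) = 0`,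
  `ψ'(ζᵢ) δζᵢ = -Γᵢ (ζᵢ δλ + δν)` with `ψ'(ζᵢ) = D ∏_{j ≠ i} (ζᵢ - ζⱼ)`, and kill `δλ, δν` by the
  partial-fraction identity `Σᵢ q(ζᵢ)/ψ'(ζᵢ) = 0` (`deg q ≤ 1`); for `δ = ∂/∂zᵢ` this is
  `Γ₃ = -Γᵢ ∂ᵢz₃` (`Gamma_formalChordZ_eq`).
* `pderiv_formalGroupLaw_neg_step` — the reflection `F = i(z₃) = -z₃/u`, `w(F) = -w₃/u`,
  `u = 1 - a₁z₃ - a₃w₃` (AEC IV.1 p. 118) acts as `-1` on `ω`: `Γ(F, w(F)) δz₃ = -Γ₃ δF`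
  (a polynomial identity modulo the curve relation, `neg_step_identity`).
* `formalEta_subst_X_mul_pderiv_formalGroupLaw` — **`η(zᵢ) · ∂ᵢ F = η(F)`**, `i = 0, 1`; and over a
  `ℚ`-algebra `formalOmega_subst_formalGroupLaw_mul_pderiv` — **`ω(F) · ∂ᵢ F = ω(zᵢ)`** for the tree's
  `formalOmega = ω/dz` (`ω · η = 1`, `FormalInvariantDerivation.lean`).

## Sources

* J. H. Silverman, *The Arithmetic of Elliptic Curves*, 2nd ed. (2009): III.5.1 (p. 74, invariance
  of `ω` under translation; the direct computation), IV.1 (pp. 115–118: `f`, `w(z)`, `λ`, `ν`, the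
  cubic in `z`, `z₃`, `i`, `F = i(z₃)`), IV.4 (invariant differential, `ω(F(T,S)) F_X(T,S) = ω(T)`),
  IV.5.2 (`SilvermanAEC2009`).

## Design notes

* Everything is an identity in `R⟦z₁, z₂⟧ = MvPowerSeries (Fin 2) R`; the derivation is Mathlib-style
  `Derivation R _ _` (the tree's `MvPowerSeries.pderiv`), and the only cancellations are by the
  non-zero-divisors `z₁ - z₂`, `zᵢ - z₃` (whence `[IsDomain R]`) and by units of constant term `±1`.
* No new definitions; the cubic `f`, its partials and `Γ` are written out in the statements.
-/

noncomputable section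

open PowerSeries Literature.NumberTheory.EllipticCurves
open Literature.AlgebraicGeometry.Resolution (MvPowerSeries.pderiv MvPowerSeries.coeff_pderiv
  MvPowerSeries.pderiv_X)

namespace WeierstrassCurve

/-! ### Pure algebra: the cubic cut out by a line, its derivative, partial fractions, reflection -/

section Algebra

variable {T : Type*} [CommRing T]

/-- The cubic in `Z` cut out on `G(z, w) = f(z, w) - w = 0` by the line `w = λZ + ν`:
`G(Z, λZ + ν) = D Z³ + N Z² + c₁ Z + c₀` with `D = 1 + a₂λ + a₄λ² + a₆λ³`,
`N = a₁λ + a₂ν + a₃λ² + 2a₄λν + 3a₆λ²ν`, `c₁ = a₁ν + 2a₃λν + a₄ν² + 3a₆λν² - λ`,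
`c₀ = a₃ν² + a₆ν³ - ν`. [Silverman AEC IV.1 (p. 117, "substituting … gives a cubic in `z`")]
[folklore] -/
theorem chordCubic_expand (a₁ a₂ a₃ a₄ a₆ L N₀ Z : T) :
    (Z ^ 3 + a₁ * Z * (L * Z + N₀) + a₂ * Z ^ 2 * (L * Z + N₀) + a₃ * (L * Z + N₀) ^ 2 +
        a₄ * Z * (L * Z + N₀) ^ 2 + a₆ * (L * Z + N₀) ^ 3) - (L * Z + N₀) =
      (1 + a₂ * L + a₄ * L ^ 2 + a₆ * L ^ 3) * Z ^ 3 +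
        (a₁ * L + a₂ * N₀ + a₃ * L ^ 2 + 2 * a₄ * L * N₀ + 3 * a₆ * L ^ 2 * N₀) * Z ^ 2 +
        (a₁ * N₀ + 2 * a₃ * L * N₀ + a₄ * N₀ ^ 2 + 3 * a₆ * L * N₀ ^ 2 - L) * Z +
        (a₃ * N₀ ^ 2 + a₆ * N₀ ^ 3 - N₀) := by
  ring

/-- **Vieta, linear remainder**: if `D · D' = 1` and `z₃ = -z₁ - z₂ - N D'`, then
`G(Z, λZ + ν) - D(Z - z₁)(Z - z₂)(Z - z₃)` has no `Z³` and no `Z²` term: it is `αZ + β` with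
`α = c₁ - D(z₁z₂ + z₁z₃ + z₂z₃)`, `β = c₀ + D z₁z₂z₃`. [Silverman AEC IV.1 (p. 117)] [folklore] -/
theorem chordCubic_sub_prod (a₁ a₂ a₃ a₄ a₆ L N₀ D D' z₁ z₂ Z : T) (hD : D * D' = 1)
    (hDdef : D = 1 + a₂ * L + a₄ * L ^ 2 + a₆ * L ^ 3) :
    (Z ^ 3 + a₁ * Z * (L * Z + N₀) + a₂ * Z ^ 2 * (L * Z + N₀) + a₃ * (L * Z + N₀) ^ 2 +
        a₄ * Z * (L * Z + N₀) ^ 2 + a₆ * (L * Z + N₀) ^ 3) - (L * Z + N₀) -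
      D * (Z - z₁) * (Z - z₂) *
        (Z - (-z₁ - z₂ - (a₁ * L + a₂ * N₀ + a₃ * L ^ 2 + 2 * a₄ * L * N₀ + 3 * a₆ * L ^ 2 * N₀) *
            D')) =
      ((a₁ * N₀ + 2 * a₃ * L * N₀ + a₄ * N₀ ^ 2 + 3 * a₆ * L * N₀ ^ 2 - L) -
          D * (z₁ * z₂ + z₁ * (-z₁ - z₂ - (a₁ * L + a₂ * N₀ + a₃ * L ^ 2 + 2 * a₄ * L * N₀ +
            3 * a₆ * L ^ 2 * N₀) * D') + z₂ * (-z₁ - z₂ - (a₁ * L + a₂ * N₀ + a₃ * L ^ 2 +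
            2 * a₄ * L * N₀ + 3 * a₆ * L ^ 2 * N₀) * D'))) * Z +
        ((a₃ * N₀ ^ 2 + a₆ * N₀ ^ 3 - N₀) +
          D * z₁ * z₂ * (-z₁ - z₂ - (a₁ * L + a₂ * N₀ + a₃ * L ^ 2 + 2 * a₄ * L * N₀ +
            3 * a₆ * L ^ 2 * N₀) * D')) := by
  subst hDdef
  linear_combination
    (-(a₁ * L + a₂ * N₀ + a₃ * L ^ 2 + 2 * a₄ * L * N₀ + 3 * a₆ * L ^ 2 * N₀) * Z ^ 2) * hD

/-- **Leibniz for the cubic along a moving line**: for a derivation `δ` killing the coefficients,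
`δ[G(ζ, λζ + ν)] = (f_z + λΓ)(ζ, λζ+ν) · δζ + Γ(ζ, λζ+ν) · (ζ δλ + δν)` where
`Γ = f_w - 1`, `f_z = 3z² + a₁w + 2a₂zw + a₄w²`, `f_w = a₁z + a₂z² + 2a₃w + 2a₄zw + 3a₆w²`.
[Silverman AEC III.5.1 (proof sketch: "use standard differentiation rules")] [folklore] -/
theorem deriv_chordCubic {R₀ : Type*} [CommRing R₀] [Algebra R₀ T] (δ : Derivation R₀ T T)
    {a₁ a₂ a₃ a₄ a₆ : T} (h₁ : δ a₁ = 0) (h₂ : δ a₂ = 0) (h₃ : δ a₃ = 0) (h₄ : δ a₄ = 0)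
    (h₆ : δ a₆ = 0) (L N₀ ζ : T) :
    δ ((ζ ^ 3 + a₁ * ζ * (L * ζ + N₀) + a₂ * ζ ^ 2 * (L * ζ + N₀) + a₃ * (L * ζ + N₀) ^ 2 +
        a₄ * ζ * (L * ζ + N₀) ^ 2 + a₆ * (L * ζ + N₀) ^ 3) - (L * ζ + N₀)) =
      ((3 * ζ ^ 2 + a₁ * (L * ζ + N₀) + 2 * a₂ * ζ * (L * ζ + N₀) + a₄ * (L * ζ + N₀) ^ 2) +
          L * (a₁ * ζ + a₂ * ζ ^ 2 + 2 * a₃ * (L * ζ + N₀) + 2 * a₄ * ζ * (L * ζ + N₀) +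
            3 * a₆ * (L * ζ + N₀) ^ 2 - 1)) * δ ζ +
        (a₁ * ζ + a₂ * ζ ^ 2 + 2 * a₃ * (L * ζ + N₀) + 2 * a₄ * ζ * (L * ζ + N₀) +
            3 * a₆ * (L * ζ + N₀) ^ 2 - 1) * (ζ * δ L + δ N₀) := by
  simp only [map_sub, map_add, Derivation.leibniz, Derivation.leibniz_pow, h₁, h₂, h₃, h₄, h₆,
    smul_eq_mul, nsmul_eq_mul]
  push_cast
  ring

/-- **Leibniz for the curve relation**: `δ[G(z, w)] = f_z(z, w) δz + Γ(z, w) δw`. [folklore] -/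
theorem deriv_curveCubic {R₀ : Type*} [CommRing R₀] [Algebra R₀ T] (δ : Derivation R₀ T T)
    {a₁ a₂ a₃ a₄ a₆ : T} (h₁ : δ a₁ = 0) (h₂ : δ a₂ = 0) (h₃ : δ a₃ = 0) (h₄ : δ a₄ = 0)
    (h₆ : δ a₆ = 0) (z w : T) :
    δ ((z ^ 3 + a₁ * z * w + a₂ * z ^ 2 * w + a₃ * w ^ 2 + a₄ * z * w ^ 2 + a₆ * w ^ 3) - w) =
      (3 * z ^ 2 + a₁ * w + 2 * a₂ * z * w + a₄ * w ^ 2) * δ z +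
        (a₁ * z + a₂ * z ^ 2 + 2 * a₃ * w + 2 * a₄ * z * w + 3 * a₆ * w ^ 2 - 1) * δ w := by
  simp only [map_sub, map_add, Derivation.leibniz, Derivation.leibniz_pow, h₁, h₂, h₃, h₄, h₆,
    smul_eq_mul, nsmul_eq_mul]
  push_cast
  ring

/-- **The derivative of the cubic at a root, from Vieta**: if `N = -D(z₁ + z₂ + z₃)` and
`c₁ = D(z₁z₂ + z₁z₃ + z₂z₃)`, then `(f_z + λΓ)(ζ, λζ + ν) = 3Dζ² + 2Nζ + c₁ =
D[(ζ - z₁)(ζ - z₂) + (ζ - z₁)(ζ - z₃) + (ζ - z₂)(ζ - z₃)]`. [folklore] -/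
theorem chordCubic_deriv_eq (a₁ a₂ a₃ a₄ a₆ L N₀ D z₁ z₂ z₃ ζ : T)
    (hD : D = 1 + a₂ * L + a₄ * L ^ 2 + a₆ * L ^ 3)
    (hN : a₁ * L + a₂ * N₀ + a₃ * L ^ 2 + 2 * a₄ * L * N₀ + 3 * a₆ * L ^ 2 * N₀ =
      -D * (z₁ + z₂ + z₃))
    (hc₁ : a₁ * N₀ + 2 * a₃ * L * N₀ + a₄ * N₀ ^ 2 + 3 * a₆ * L * N₀ ^ 2 - L =
      D * (z₁ * z₂ + z₁ * z₃ + z₂ * z₃)) :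
    (3 * ζ ^ 2 + a₁ * (L * ζ + N₀) + 2 * a₂ * ζ * (L * ζ + N₀) + a₄ * (L * ζ + N₀) ^ 2) +
        L * (a₁ * ζ + a₂ * ζ ^ 2 + 2 * a₃ * (L * ζ + N₀) + 2 * a₄ * ζ * (L * ζ + N₀) +
          3 * a₆ * (L * ζ + N₀) ^ 2 - 1) =
      D * ((ζ - z₁) * (ζ - z₂) + (ζ - z₁) * (ζ - z₃) + (ζ - z₂) * (ζ - z₃)) := by
  subst hD
  linear_combination (2 * ζ) * hN + hc₁

/-- **Partial fractions / Abel's relation for three collinear points**: from the three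
differentiated incidence relations `D ∏_{j≠i}(ζᵢ - ζⱼ) δζᵢ + Γᵢ (ζᵢ δλ + δν) = 0`, the
combination with weights `(ζⱼ - ζₖ) Γⱼ Γₖ` eliminates `δλ, δν`
(`Σᵢ (ζᵢ δλ + δν)(ζⱼ - ζₖ) = 0`) and leaves
`D · (z₁-z₂)(z₁-z₃)(z₂-z₃) · (Γ₂Γ₃ δz₁ + Γ₁Γ₃ δz₂ + Γ₁Γ₂ δz₃) = 0`.
[Silverman AEC III.5.1 (direct proof)] [folklore] -/
theorem abel_combination {z₁ z₂ z₃ D Γ₁ Γ₂ Γ₃ d₁ d₂ d₃ dL dN : T}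
    (h₁ : D * (z₁ - z₂) * (z₁ - z₃) * d₁ + Γ₁ * (z₁ * dL + dN) = 0)
    (h₂ : D * (z₂ - z₁) * (z₂ - z₃) * d₂ + Γ₂ * (z₂ * dL + dN) = 0)
    (h₃ : D * (z₃ - z₁) * (z₃ - z₂) * d₃ + Γ₃ * (z₃ * dL + dN) = 0) :
    D * ((z₁ - z₂) * (z₁ - z₃) * (z₂ - z₃)) * (Γ₂ * Γ₃ * d₁ + Γ₁ * Γ₃ * d₂ + Γ₁ * Γ₂ * d₃) = 0 := by
  linear_combination (z₂ - z₃) * Γ₂ * Γ₃ * h₁ + (z₃ - z₁) * Γ₁ * Γ₃ * h₂ + (z₁ - z₂) * Γ₁ * Γ₂ * h₃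

/-- **The reflection `(z, w) ↦ (-z/u, -w/u)`, `u = 1 - a₁z - a₃w`, acts as `-1` on `dz/Γ`**
(`[-1]^* ω = -ω`, AEC III.5.2 proof / IV.1 p. 118): if `(z, w)` is on the cubic (`h0`), `(dz, dw)`
is tangent (`h1`), `F u = -z`, `W u = -w` and `dF u + F du + dz = 0` with `du = -a₁dz - a₃dw`
(the derivative of `F u = -z`), then `u² (dF · Γ(z, w) + dz · Γ(F, W)) = 0`. [Silverman AEC
III.5.2 (proof, `[-1]^*ω = -ω`), IV.1 (p. 118)] [folklore] -/
theorem neg_step_identity (a₁ a₂ a₃ a₄ a₆ z w dz dw F W' dF : T)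
    (h0 : (z ^ 3 + a₁ * z * w + a₂ * z ^ 2 * w + a₃ * w ^ 2 + a₄ * z * w ^ 2 + a₆ * w ^ 3) - w = 0)
    (h1 : (3 * z ^ 2 + a₁ * w + 2 * a₂ * z * w + a₄ * w ^ 2) * dz +
      (a₁ * z + a₂ * z ^ 2 + 2 * a₃ * w + 2 * a₄ * z * w + 3 * a₆ * w ^ 2 - 1) * dw = 0)
    (h3 : F * (1 - a₁ * z - a₃ * w) + z = 0) (h4 : W' * (1 - a₁ * z - a₃ * w) + w = 0)
    (h5 : dF * (1 - a₁ * z - a₃ * w) + F * (-a₁ * dz - a₃ * dw) + dz = 0) :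
    (1 - a₁ * z - a₃ * w) ^ 2 *
        (dF * (a₁ * z + a₂ * z ^ 2 + 2 * a₃ * w + 2 * a₄ * z * w + 3 * a₆ * w ^ 2 - 1) +
          dz * (a₁ * F + a₂ * F ^ 2 + 2 * a₃ * W' + 2 * a₄ * F * W' + 3 * a₆ * W' ^ 2 - 1)) =
              0 := by
  -- `u² Γ(F, W) = Q := -a₁uz + a₂z² - 2a₃uw + 2a₄zw + 3a₆w² - u²` modulo `h3`, `h4`
  have hQ : (1 - a₁ * z - a₃ * w) ^ 2 *
      (a₁ * F + a₂ * F ^ 2 + 2 * a₃ * W' + 2 * a₄ * F * W' + 3 * a₆ * W' ^ 2 - 1) =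
      -a₁ * (1 - a₁ * z - a₃ * w) * z + a₂ * z ^ 2 - 2 * a₃ * (1 - a₁ * z - a₃ * w) * w +
        2 * a₄ * z * w + 3 * a₆ * w ^ 2 - (1 - a₁ * z - a₃ * w) ^ 2 := by
    linear_combination
      (a₁ * (1 - a₁ * z - a₃ * w) + a₂ * ((1 - a₁ * z - a₃ * w) * F - z) +
          2 * a₄ * (1 - a₁ * z - a₃ * w) * W') * h3 +
        (2 * a₃ * (1 - a₁ * z - a₃ * w) - 2 * a₄ * z +
          3 * a₆ * ((1 - a₁ * z - a₃ * w) * W' - w)) * h4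
  -- Euler's identity `z f_z + w Γ = 3G + w(1 + u)` turns `(1 - a₃w)Γ - a₃ z f_z` into `Q - 3a₃G`
  linear_combination
    ((1 - a₁ * z - a₃ * w) *
        (a₁ * z + a₂ * z ^ 2 + 2 * a₃ * w + 2 * a₄ * z * w + 3 * a₆ * w ^ 2 - 1)) * h5 +
      (-(a₁ * z + a₂ * z ^ 2 + 2 * a₃ * w + 2 * a₄ * z * w + 3 * a₆ * w ^ 2 - 1) *
        (-a₁ * dz - a₃ * dw)) * h3 +
      (-a₃ * z) * h1 + (3 * a₃ * dz) * h0 + dz * hQ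

end Algebra

/-! ### The chord in `R⟦z₁, z₂⟧`: incidence of the three points and Vieta -/

section Formal

variable {R : Type*} [CommRing R] (W : WeierstrassCurve R)


/-- `λ z₁ + ν = w(z₁)`: the first point lies on the chord (definition of `ν`). [Silverman AEC IV.1
(p. 116, `ν = w₁ - λz₁`)] [folklore] -/
theorem formalSlope_mul_X_zero_add_formalIntercept :
    W.formalSlope * (MvPowerSeries.X 0 : MvPowerSeries (Fin 2) R) + W.formalIntercept =
        W.formalW.subst (MvPowerSeries.X 0 : MvPowerSeries (Fin 2) R) := by
  rw [formalIntercept]; ring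

/-- `λ z₂ + ν = w(z₂)`: the second point lies on the chord (`λ(z₂ - z₁) = w₂ - w₁`).
[Silverman AEC IV.1 (p. 116)] [folklore] -/
theorem formalSlope_mul_X_one_add_formalIntercept :
    W.formalSlope * (MvPowerSeries.X 1 : MvPowerSeries (Fin 2) R) + W.formalIntercept =
        W.formalW.subst (MvPowerSeries.X 1 : MvPowerSeries (Fin 2) R) := by
  rw [formalIntercept]
  linear_combination W.formalSlope_mul_sub

/-- `D · D⁻¹ = 1` for the leading coefficient of the chord cubic. [folklore] -/
theorem formalChordDenom_mul_invOfUnit :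
    W.formalChordDenom * MvPowerSeries.invOfUnit W.formalChordDenom 1 = 1 :=
  MvPowerSeries.mul_invOfUnit _ 1 (by rw [constantCoeff_formalChordDenom, Units.val_one])

/-- `w(zᵢ)` solves the fixed-point equation with parameter `zᵢ`, i.e. `G(zᵢ, w(zᵢ)) = 0`.
[Silverman AEC IV.1.1(a)] [folklore] -/
theorem curveCubic_formalW_subst_X (i : Fin 2) :
    ((MvPowerSeries.X i : MvPowerSeries (Fin 2) R) ^ 3 + MvPowerSeries.C W.a₁ * MvPowerSeries.X i *
        W.formalW.subst (MvPowerSeries.X i : MvPowerSeries (Fin 2) R) +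
        MvPowerSeries.C W.a₂ * (MvPowerSeries.X i : MvPowerSeries (Fin 2) R) ^ 2 *
            W.formalW.subst (MvPowerSeries.X i : MvPowerSeries (Fin 2) R) +
        MvPowerSeries.C W.a₃ * (W.formalW.subst (MvPowerSeries.X i : MvPowerSeries (Fin 2) R)) ^ 2 +
        MvPowerSeries.C W.a₄ * MvPowerSeries.X i *
            (W.formalW.subst (MvPowerSeries.X i : MvPowerSeries (Fin 2) R)) ^ 2 +
        MvPowerSeries.C W.a₆ *
            (W.formalW.subst (MvPowerSeries.X i : MvPowerSeries (Fin 2) R)) ^ 3) -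
      W.formalW.subst (MvPowerSeries.X i : MvPowerSeries (Fin 2) R) = 0 := by
  rw [sub_eq_zero]
  exact (W.formalW_subst_eq_fixedPoint (PowerSeries.HasSubst.X i)).symm

/-- `z₁ - z₂ ≠ 0` in `R⟦z₁, z₂⟧` (`R` nontrivial). [folklore] -/
theorem X_zero_sub_X_one_ne_zero [Nontrivial R] : (MvPowerSeries.X 0 : MvPowerSeries (Fin 2) R) -
    (MvPowerSeries.X 1 : MvPowerSeries (Fin 2) R) ≠ 0 := by
  classical
  intro h
  have := congrArg (MvPowerSeries.coeff (Finsupp.single (0 : Fin 2) 1)) h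
  rw [map_sub, MvPowerSeries.coeff_index_single_X, MvPowerSeries.coeff_index_single_X, if_pos rfl,
    if_neg (by decide), sub_zero, map_zero] at this
  exact one_ne_zero this

variable [IsDomain R]

/-- **Vieta for the chord cubic (coefficients)**: with `z₃ = formalChordZ`,
`c₁ = D(z₁z₂ + z₁z₃ + z₂z₃)` and `c₀ = -D z₁z₂z₃`, where `c₁ = a₁ν + 2a₃λν + a₄ν² + 3a₆λν² - λ`,
`c₀ = a₃ν² + a₆ν³ - ν` are the lower coefficients of `G(Z, λZ + ν)` — because the linear
remainder `G(Z, λZ+ν) - D(Z-z₁)(Z-z₂)(Z-z₃)` vanishes at `z₁ ≠ z₂`. [Silverman AEC IV.1 (p. 117,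
"two of whose roots are `z₁` and `z₂`")] [cite: SilvermanAEC2009, IV.1.1] -/
theorem formalChord_vieta_coeff :
    MvPowerSeries.C W.a₁ * W.formalIntercept + 2 * MvPowerSeries.C W.a₃ * W.formalSlope *
        W.formalIntercept +
          MvPowerSeries.C W.a₄ * W.formalIntercept ^ 2 + 3 * MvPowerSeries.C W.a₆ * W.formalSlope *
              W.formalIntercept ^ 2 -
          W.formalSlope =
        W.formalChordDenom * ((MvPowerSeries.X 0 : MvPowerSeries (Fin 2) R) *
            (MvPowerSeries.X 1 : MvPowerSeries (Fin 2) R) +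
            (MvPowerSeries.X 0 : MvPowerSeries (Fin 2) R) * W.formalChordZ +
            (MvPowerSeries.X 1 : MvPowerSeries (Fin 2) R) * W.formalChordZ) ∧
      MvPowerSeries.C W.a₃ * W.formalIntercept ^ 2 + MvPowerSeries.C W.a₆ * W.formalIntercept ^ 3 -
          W.formalIntercept =
        -W.formalChordDenom * (MvPowerSeries.X 0 : MvPowerSeries (Fin 2) R) *
            (MvPowerSeries.X 1 : MvPowerSeries (Fin 2) R) * W.formalChordZ := by
  set L := W.formalSlope with hL
  set N₀ := W.formalIntercept with hN₀
  set D := W.formalChordDenom with hD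
  set D' := MvPowerSeries.invOfUnit W.formalChordDenom 1 with hD'
  have hDD' : D * D' = 1 := W.formalChordDenom_mul_invOfUnit
  have hDdef : D = 1 + MvPowerSeries.C W.a₂ * L + MvPowerSeries.C W.a₄ * L ^ 2 +
      MvPowerSeries.C W.a₆ * L ^ 3 := rfl
  have hz₃ : W.formalChordZ = -(MvPowerSeries.X 0 : MvPowerSeries (Fin 2) R) -
      (MvPowerSeries.X 1 : MvPowerSeries (Fin 2) R) - (MvPowerSeries.C W.a₁ * L +
      MvPowerSeries.C W.a₂ * N₀ + MvPowerSeries.C W.a₃ * L ^ 2 +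
      2 * MvPowerSeries.C W.a₄ * L * N₀ + 3 * MvPowerSeries.C W.a₆ * L ^ 2 * N₀) * D' := rfl
  -- the linear remainder `αZ + β`
  set α := (MvPowerSeries.C W.a₁ * N₀ + 2 * MvPowerSeries.C W.a₃ * L * N₀ + MvPowerSeries.C W.a₄ *
      N₀ ^ 2 + 3 * MvPowerSeries.C W.a₆ * L * N₀ ^ 2 - L) -
      D * ((MvPowerSeries.X 0 : MvPowerSeries (Fin 2) R) *
          (MvPowerSeries.X 1 : MvPowerSeries (Fin 2) R) +
          (MvPowerSeries.X 0 : MvPowerSeries (Fin 2) R) * W.formalChordZ +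
          (MvPowerSeries.X 1 : MvPowerSeries (Fin 2) R) * W.formalChordZ) with hα
  set β := (MvPowerSeries.C W.a₃ * N₀ ^ 2 + MvPowerSeries.C W.a₆ * N₀ ^ 3 - N₀) + D *
      (MvPowerSeries.X 0 : MvPowerSeries (Fin 2) R) *
      (MvPowerSeries.X 1 : MvPowerSeries (Fin 2) R) * W.formalChordZ with hβ
  have hrem : ∀ Z : MvPowerSeries (Fin 2) R,
      (Z ^ 3 + MvPowerSeries.C W.a₁ * Z * (L * Z + N₀) + MvPowerSeries.C W.a₂ * Z ^ 2 * (L * Z +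
          N₀) + MvPowerSeries.C W.a₃ * (L * Z + N₀) ^ 2 +
          MvPowerSeries.C W.a₄ * Z * (L * Z + N₀) ^ 2 + MvPowerSeries.C W.a₆ * (L * Z + N₀) ^ 3) -
              (L * Z + N₀) -
        D * (Z - (MvPowerSeries.X 0 : MvPowerSeries (Fin 2) R)) * (Z -
            (MvPowerSeries.X 1 : MvPowerSeries (Fin 2) R)) * (Z - W.formalChordZ) = α * Z + β := by
    intro Z
    rw [hα, hβ, hz₃]
    exact chordCubic_sub_prod _ _ _ _ _ L N₀ D D' (MvPowerSeries.X 0 : MvPowerSeries (Fin 2) R)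
        (MvPowerSeries.X 1 : MvPowerSeries (Fin 2) R) Z hDD' hDdef
  -- it vanishes at `z₁` and `z₂`
  have hr₁ : α * (MvPowerSeries.X 0 : MvPowerSeries (Fin 2) R) + β = 0 := by
    have h := hrem (MvPowerSeries.X 0 : MvPowerSeries (Fin 2) R)
    rw [sub_self, mul_zero, zero_mul, zero_mul, sub_zero] at h
    rw [← h, hL, hN₀, W.formalSlope_mul_X_zero_add_formalIntercept]
    exact W.curveCubic_formalW_subst_X 0
  have hr₂ : α * (MvPowerSeries.X 1 : MvPowerSeries (Fin 2) R) + β = 0 := by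
    have h := hrem (MvPowerSeries.X 1 : MvPowerSeries (Fin 2) R)
    rw [sub_self, mul_zero, zero_mul, sub_zero] at h
    rw [← h, hL, hN₀, W.formalSlope_mul_X_one_add_formalIntercept]
    exact W.curveCubic_formalW_subst_X 1
  have hα0 : α = 0 := by
    have h : α * ((MvPowerSeries.X 0 : MvPowerSeries (Fin 2) R) -
        (MvPowerSeries.X 1 : MvPowerSeries (Fin 2) R)) = 0 := by linear_combination hr₁ - hr₂
    exact (mul_eq_zero.mp h).resolve_right X_zero_sub_X_one_ne_zero
  have hβ0 : β = 0 := by rw [← hr₁, hα0, zero_mul, zero_add]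
  exact ⟨sub_eq_zero.mp (by rw [← hα0]), by linear_combination hβ0⟩

/-- **Vieta for the chord cubic**: `G(Z, λZ + ν) = D (Z - z₁)(Z - z₂)(Z - z₃)` for every
`Z ∈ R⟦z₁, z₂⟧`. [Silverman AEC IV.1 (p. 117)] [cite: SilvermanAEC2009, IV.1.1] -/
theorem formalChord_vieta (Z : MvPowerSeries (Fin 2) R) :
    (Z ^ 3 + MvPowerSeries.C W.a₁ * Z * (W.formalSlope * Z + W.formalIntercept) +
          MvPowerSeries.C W.a₂ * Z ^ 2 * (W.formalSlope * Z + W.formalIntercept) +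
          MvPowerSeries.C W.a₃ * (W.formalSlope * Z + W.formalIntercept) ^ 2 +
          MvPowerSeries.C W.a₄ * Z * (W.formalSlope * Z + W.formalIntercept) ^ 2 +
          MvPowerSeries.C W.a₆ * (W.formalSlope * Z + W.formalIntercept) ^ 3) -
        (W.formalSlope * Z + W.formalIntercept) =
      W.formalChordDenom * (Z - (MvPowerSeries.X 0 : MvPowerSeries (Fin 2) R)) * (Z -
          (MvPowerSeries.X 1 : MvPowerSeries (Fin 2) R)) * (Z - W.formalChordZ) := by
  obtain ⟨hc₁, hc₀⟩ := W.formalChord_vieta_coeff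
  have hDD' := W.formalChordDenom_mul_invOfUnit
  have hz₃ : W.formalChordZ = -(MvPowerSeries.X 0 : MvPowerSeries (Fin 2) R) -
      (MvPowerSeries.X 1 : MvPowerSeries (Fin 2) R) - W.formalChordNum *
      MvPowerSeries.invOfUnit W.formalChordDenom 1 :=
    rfl
  have hN : W.formalChordNum = -W.formalChordDenom *
      ((MvPowerSeries.X 0 : MvPowerSeries (Fin 2) R) +
      (MvPowerSeries.X 1 : MvPowerSeries (Fin 2) R) + W.formalChordZ) := by
    rw [hz₃]; linear_combination (-W.formalChordNum) * hDD'
  rw [chordCubic_expand]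
  unfold formalChordNum at hN
  unfold formalChordDenom at hN hc₁ hc₀ ⊢
  linear_combination Z ^ 2 * hN + Z * hc₁ + hc₀

/-- The third intersection `(z₃, w₃)`, `w₃ = λz₃ + ν`, lies on the cubic: `G(z₃, w₃) = 0`.
[Silverman AEC IV.1 (p. 117)] [folklore] -/
theorem curveCubic_formalChordZ :
    (W.formalChordZ ^ 3 + MvPowerSeries.C W.a₁ * W.formalChordZ * (W.formalSlope * W.formalChordZ +
        W.formalIntercept) +
          MvPowerSeries.C W.a₂ * W.formalChordZ ^ 2 * (W.formalSlope * W.formalChordZ +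
              W.formalIntercept) +
          MvPowerSeries.C W.a₃ * (W.formalSlope * W.formalChordZ + W.formalIntercept) ^ 2 +
          MvPowerSeries.C W.a₄ * W.formalChordZ * (W.formalSlope * W.formalChordZ +
              W.formalIntercept) ^ 2 +
          MvPowerSeries.C W.a₆ * (W.formalSlope * W.formalChordZ + W.formalIntercept) ^ 3) -
        (W.formalSlope * W.formalChordZ + W.formalIntercept) = 0 := by
  rw [W.formalChord_vieta, sub_self, mul_zero]

/-- **`w(z₃) = λz₃ + ν`**: the `w`-coordinate of the third intersection is `w(z₃)` (both solve the
fixed-point equation with parameter `z₃`, AEC IV.1.1(b)). [Silverman AEC IV.1 (pp. 117–118)]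
[cite: SilvermanAEC2009, IV.1.1] -/
theorem formalW_subst_formalChordZ :
    W.formalW.subst W.formalChordZ = W.formalSlope * W.formalChordZ + W.formalIntercept := by
  refine W.fixedPoint_unique (g := W.formalChordZ) W.constantCoeff_formalChordZ ?_ ?_
    (W.formalW_subst_eq_fixedPoint W.hasSubst_formalChordZ) ?_
  · exact constantCoeff_powerSeries_subst_eq_zero W.constantCoeff_formalChordZ W.constantCoeff_formalW
  · simp [W.constantCoeff_formalChordZ, W.constantCoeff_formalIntercept]
  · exact (sub_eq_zero.mp W.curveCubic_formalChordZ).symm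


/-! ### Orders and low coefficients: `λ, ν, N ∈ (z₁, z₂)²`, `z₃ = -z₁ - z₂ + (deg ≥ 2)` -/

omit [IsDomain R] in
/-- `n ≤ ord f`, `n ≤ ord g` give `n ≤ ord (f + g)`. [folklore] -/
theorem _root_.Literature.NumberTheory.EllipticCurves.le_order_add_of_le {σ : Type*}
    {f g : MvPowerSeries σ R} {n : ℕ∞} (hf : n ≤ f.order) (hg : n ≤ g.order) : n ≤ (f + g).order :=
  le_trans (le_min hf hg) MvPowerSeries.min_order_le_add

omit [IsDomain R] in
/-- `n ≤ ord f`, `n ≤ ord g` give `n ≤ ord (f - g)`. [folklore] -/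
theorem _root_.Literature.NumberTheory.EllipticCurves.le_order_sub_of_le {σ : Type*}
    {f g : MvPowerSeries σ R} {n : ℕ∞} (hf : n ≤ f.order) (hg : n ≤ g.order) : n ≤ (f -
        g).order := by
  rw [sub_eq_add_neg]
  exact le_order_add_of_le hf (by rwa [MvPowerSeries.order_neg])

omit [IsDomain R] in
/-- `n ≤ ord f` gives `n ≤ ord (g · f)`. [folklore] -/
theorem _root_.Literature.NumberTheory.EllipticCurves.le_order_mul_of_le_right {σ : Type*}
    {f : MvPowerSeries σ R} (g : MvPowerSeries σ R) {n : ℕ∞} (hf : n ≤ f.order) : n ≤ (g *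
        f).order :=
  le_trans hf (le_trans le_add_self MvPowerSeries.le_order_mul)

omit [IsDomain R] in
/-- `n ≤ ord f` gives `n ≤ ord (f · g)`. [folklore] -/
theorem _root_.Literature.NumberTheory.EllipticCurves.le_order_mul_of_le_left {σ : Type*}
    {f : MvPowerSeries σ R} (g : MvPowerSeries σ R) {n : ℕ∞} (hf : n ≤ f.order) : n ≤ (f *
        g).order :=
  le_trans hf (le_trans le_self_add MvPowerSeries.le_order_mul)

omit [IsDomain R] in
/-- The degree of an exponent vector on `Fin 2` is `d 0 + d 1`. [folklore] -/
theorem _root_.Literature.NumberTheory.EllipticCurves.finsupp_degree_fin_two (d : Fin 2 →₀ ℕ) :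
    Finsupp.degree d = d 0 + d 1 := by
  rw [Finsupp.degree_eq_sum, Fin.sum_univ_two]

omit [IsDomain R] in
/-- `λ ∈ (z₁, z₂)²`: no terms of degree `< 2` (`w = z³ + ⋯`). [Silverman AEC IV.1] [folklore] -/
theorem two_le_order_formalSlope : ((2 : ℕ) : ℕ∞) ≤ W.formalSlope.order :=
  MvPowerSeries.nat_le_order fun d hd => by
    show coeff (d 0 + d 1 + 1) W.formalW = 0
    rw [finsupp_degree_fin_two] at hd
    exact W.coeff_formalW_of_lt_three (by omega)

omit [IsDomain R] in
/-- `w(zᵢ) ∈ (z₁, z₂)²` (indeed `³`). [Silverman AEC IV.1] [folklore] -/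
theorem two_le_order_formalW_subst_X (i : Fin 2) :
    ((2 : ℕ) : ℕ∞) ≤ (W.formalW.subst (MvPowerSeries.X i : MvPowerSeries (Fin 2) R)).order := by
  classical
  refine MvPowerSeries.nat_le_order fun d hd => ?_
  rw [coeff_powerSeries_subst_X]
  split_ifs with h
  · apply W.coeff_formalW_of_lt_three
    have : Finsupp.degree d = d i := by rw [h, Finsupp.degree_single]; simp
    omega
  · rfl

omit [IsDomain R] in
/-- `ν ∈ (z₁, z₂)²`. [Silverman AEC IV.1] [folklore] -/
theorem two_le_order_formalIntercept : ((2 : ℕ) : ℕ∞) ≤ W.formalIntercept.order :=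
  le_order_sub_of_le (W.two_le_order_formalW_subst_X 0)
    (le_order_mul_of_le_left _ W.two_le_order_formalSlope)

omit [IsDomain R] in
/-- `N = a₁λ + a₂ν + a₃λ² + 2a₄λν + 3a₆λ²ν ∈ (z₁, z₂)²`. [Silverman AEC IV.1] [folklore] -/
theorem two_le_order_formalChordNum : ((2 : ℕ) : ℕ∞) ≤ W.formalChordNum.order := by
  have hL := W.two_le_order_formalSlope
  have hN := W.two_le_order_formalIntercept
  have hL2 : ((2 : ℕ) : ℕ∞) ≤ (W.formalSlope ^ 2).order := by
    rw [sq]; exact le_order_mul_of_le_right _ hL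
  unfold formalChordNum
  exact le_order_add_of_le (le_order_add_of_le (le_order_add_of_le (le_order_add_of_le
    (le_order_mul_of_le_right _ hL) (le_order_mul_of_le_right _ hN))
    (le_order_mul_of_le_right _ hL2)) (le_order_mul_of_le_right _ hN))
        (le_order_mul_of_le_right _ hN)

omit [IsDomain R] in
/-- **`z₃ = -z₁ - z₂ + (degree ≥ 2)`**: the coefficient of `zⱼ` in `z₃` is `-1`.
[Silverman AEC IV.1 (p. 117), IV.2 (`F = z₁ + z₂ + ⋯`)] [folklore] -/
theorem coeff_single_formalChordZ (j : Fin 2) :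
    MvPowerSeries.coeff (Finsupp.single j 1) W.formalChordZ = -1 := by
  classical
  have h2 : ((2 : ℕ) : ℕ∞) ≤ (W.formalChordNum *
      MvPowerSeries.invOfUnit W.formalChordDenom 1).order :=
    le_order_mul_of_le_left _ W.two_le_order_formalChordNum
  have h0 : MvPowerSeries.coeff (Finsupp.single j 1)
      (W.formalChordNum * MvPowerSeries.invOfUnit W.formalChordDenom 1) = 0 := by
    apply MvPowerSeries.coeff_of_lt_order
    refine lt_of_lt_of_le ?_ h2
    rw [Finsupp.degree_single]; exact_mod_cast Nat.one_lt_two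
  rw [formalChordZ, map_sub, map_sub, map_neg, h0, sub_zero, MvPowerSeries.coeff_index_single_X,
    MvPowerSeries.coeff_index_single_X]
  fin_cases j <;> simp

omit [IsDomain R] in
/-- `zᵢ - z₃ ≠ 0` (its `zⱼ`-coefficient, `j ≠ i`, is `1`). [folklore] -/
theorem X_sub_formalChordZ_ne_zero [Nontrivial R] (i j : Fin 2) (hij : j ≠ i) :
    (MvPowerSeries.X i : MvPowerSeries (Fin 2) R) - W.formalChordZ ≠ 0 := by
  classical
  intro h
  have := congrArg (MvPowerSeries.coeff (Finsupp.single j 1)) h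
  rw [map_sub, MvPowerSeries.coeff_index_single_X, if_neg hij, W.coeff_single_formalChordZ,
    map_zero] at this
  norm_num at this

omit [IsDomain R] in
/-- `D ≠ 0` (constant term `1`). [folklore] -/
theorem formalChordDenom_ne_zero [Nontrivial R] : W.formalChordDenom ≠ 0 := fun h => by
  have := congrArg MvPowerSeries.constantCoeff h
  rw [constantCoeff_formalChordDenom, map_zero] at this
  exact one_ne_zero this

omit [IsDomain R] in
/-- `∂z₃/∂zᵢ` is a unit of `R⟦z₁, z₂⟧` (constant term `-1`). [folklore] -/
theorem isUnit_pderiv_formalChordZ (i : Fin 2) : IsUnit (MvPowerSeries.pderiv i W.formalChordZ) := by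
  rw [MvPowerSeries.isUnit_iff_constantCoeff, ← MvPowerSeries.coeff_zero_eq_constantCoeff_apply,
    MvPowerSeries.coeff_pderiv, zero_add, W.coeff_single_formalChordZ]
  simp

/-! ### `η` and `Γ = f_w - 1` under substitution -/

omit [IsDomain R] in
/-- `Γ(g, ω)` has constant term `-1` when `g, ω` have none. [folklore] -/
theorem constantCoeff_Gamma {g ω : MvPowerSeries (Fin 2) R} (hg : MvPowerSeries.constantCoeff g = 0)
    (hω : MvPowerSeries.constantCoeff ω = 0) : MvPowerSeries.constantCoeff ((MvPowerSeries.C W.a₁ *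
        g + MvPowerSeries.C W.a₂ * g ^ 2 + 2 * MvPowerSeries.C W.a₃ * (ω) +
        2 * MvPowerSeries.C W.a₄ * g * (ω) + 3 * MvPowerSeries.C W.a₆ * (ω) ^ 2 - 1)) = -1 := by
  simp [hg, hω]

omit [IsDomain R] in
/-- **`η(g) = 1 - f_w(g, w(g)) = -Γ(g, w(g))`** for any substitutable `g` (`η = formalEta` is a
polynomial in `z` and `w(z)`, and substitution is a ring homomorphism). [Silverman AEC IV.1]
[folklore] -/
theorem formalEta_subst {g : MvPowerSeries (Fin 2) R} (hg : PowerSeries.HasSubst g) :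
    W.formalEta.subst g = -(MvPowerSeries.C W.a₁ * g + MvPowerSeries.C W.a₂ * g ^ 2 + 2 *
        MvPowerSeries.C W.a₃ * (W.formalW.subst g) +
        2 * MvPowerSeries.C W.a₄ * g * (W.formalW.subst g) + 3 * MvPowerSeries.C W.a₆ *
            (W.formalW.subst g) ^ 2 - 1) := by
  have hC : ∀ a : R, (PowerSeries.C a).subst g = MvPowerSeries.C a := fun a => PowerSeries.subst_C a
  rw [formalEta_def]
  simp only [← PowerSeries.coe_substAlgHom hg, map_add, map_sub, map_one, map_mul, map_pow,
    map_ofNat, PowerSeries.substAlgHom_X]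
  simp only [PowerSeries.coe_substAlgHom hg, hC]
  ring

/-! ### Abel's relation for the moving chord -/

omit [IsDomain R] in
/-- A derivation of `R⟦z₁, z₂⟧` kills the coefficients `aᵢ`. [folklore] -/
theorem derivation_C_eq_zero (δ : Derivation R (MvPowerSeries (Fin 2) R)
    (MvPowerSeries (Fin 2) R)) (a : R) : δ (MvPowerSeries.C a) = 0 := by
  rw [MvPowerSeries.c_eq_algebraMap]; exact δ.map_algebraMap a

/-- **Differentiated incidence**: if `G(ζ, λζ + ν) = 0` then for every derivation `δ`,
`D[(ζ-z₁)(ζ-z₂) + (ζ-z₁)(ζ-z₃) + (ζ-z₂)(ζ-z₃)] δζ + Γ(ζ, λζ+ν)(ζ δλ + δν) = 0`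
(the `Z`-derivative of the cubic at `ζ` in factored form, by Vieta). [Silverman AEC III.5.1
(direct proof)] [folklore] -/
theorem chord_incidence_deriv (δ : Derivation R (MvPowerSeries (Fin 2) R)
    (MvPowerSeries (Fin 2) R)) {ζ : MvPowerSeries (Fin 2) R}
    (hζ : (ζ ^ 3 + MvPowerSeries.C W.a₁ * ζ * (W.formalSlope * ζ + W.formalIntercept) +
          MvPowerSeries.C W.a₂ * ζ ^ 2 * (W.formalSlope * ζ + W.formalIntercept) +
          MvPowerSeries.C W.a₃ * (W.formalSlope * ζ + W.formalIntercept) ^ 2 +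
          MvPowerSeries.C W.a₄ * ζ * (W.formalSlope * ζ + W.formalIntercept) ^ 2 +
          MvPowerSeries.C W.a₆ * (W.formalSlope * ζ + W.formalIntercept) ^ 3) -
        (W.formalSlope * ζ + W.formalIntercept) = 0) :
    W.formalChordDenom * ((ζ - (MvPowerSeries.X 0 : MvPowerSeries (Fin 2) R)) * (ζ -
        (MvPowerSeries.X 1 : MvPowerSeries (Fin 2) R)) + (ζ -
        (MvPowerSeries.X 0 : MvPowerSeries (Fin 2) R)) * (ζ - W.formalChordZ) +
          (ζ - (MvPowerSeries.X 1 : MvPowerSeries (Fin 2) R)) * (ζ - W.formalChordZ)) * δ ζ +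
      (MvPowerSeries.C W.a₁ * (ζ) + MvPowerSeries.C W.a₂ * (ζ) ^ 2 + 2 * MvPowerSeries.C W.a₃ *
          (W.formalSlope * ζ + W.formalIntercept) +
        2 * MvPowerSeries.C W.a₄ * (ζ) * (W.formalSlope * ζ + W.formalIntercept) + 3 *
            MvPowerSeries.C W.a₆ * (W.formalSlope * ζ + W.formalIntercept) ^ 2 - 1) *
        (ζ * δ W.formalSlope + δ W.formalIntercept) = 0 := by
  have hc₁ := W.formalChord_vieta_coeff.1
  have hDD' := W.formalChordDenom_mul_invOfUnit
  have hz₃ : W.formalChordZ = -(MvPowerSeries.X 0 : MvPowerSeries (Fin 2) R) -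
      (MvPowerSeries.X 1 : MvPowerSeries (Fin 2) R) - W.formalChordNum *
      MvPowerSeries.invOfUnit W.formalChordDenom 1 :=
    rfl
  have hN : W.formalChordNum = -W.formalChordDenom *
      ((MvPowerSeries.X 0 : MvPowerSeries (Fin 2) R) +
      (MvPowerSeries.X 1 : MvPowerSeries (Fin 2) R) + W.formalChordZ) := by
    rw [hz₃]; linear_combination (-W.formalChordNum) * hDD'
  have h := congrArg δ hζ
  rw [map_zero, deriv_chordCubic δ (derivation_C_eq_zero δ _) (derivation_C_eq_zero δ _)
    (derivation_C_eq_zero δ _) (derivation_C_eq_zero δ _) (derivation_C_eq_zero δ _),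
    chordCubic_deriv_eq _ _ _ _ _ _ _ W.formalChordDenom (MvPowerSeries.X 0 : MvPowerSeries (Fin 2) R)
      (MvPowerSeries.X 1 : MvPowerSeries (Fin 2) R) W.formalChordZ ζ rfl hN hc₁] at h
  exact h

/-- **Abel's relation for the three collinear points** `(z₁, w₁), (z₂, w₂), (z₃, w₃)`: for every
`R`-derivation `δ` of `R⟦z₁, z₂⟧`, `Γ₂Γ₃ δz₁ + Γ₁Γ₃ δz₂ + Γ₁Γ₂ δz₃ = 0`, i.e. `Σ δzᵢ/Γ(zᵢ, wᵢ) = 0`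
(`dz/Γ = -ω`): the sum of the invariant differential over the intersection with a moving line
vanishes. [Silverman AEC III.5.1 (direct proof), III.5.2] [folklore] -/
theorem abel_relation (δ : Derivation R (MvPowerSeries (Fin 2) R) (MvPowerSeries (Fin 2) R)) :
    (MvPowerSeries.C W.a₁ * (MvPowerSeries.X 1 : MvPowerSeries (Fin 2) R) + MvPowerSeries.C W.a₂ *
        (MvPowerSeries.X 1 : MvPowerSeries (Fin 2) R) ^ 2 + 2 * MvPowerSeries.C W.a₃ *
        (W.formalW.subst (MvPowerSeries.X 1 : MvPowerSeries (Fin 2) R)) +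
        2 * MvPowerSeries.C W.a₄ * (MvPowerSeries.X 1 : MvPowerSeries (Fin 2) R) *
            (W.formalW.subst (MvPowerSeries.X 1 : MvPowerSeries (Fin 2) R)) + 3 *
            MvPowerSeries.C W.a₆ *
            (W.formalW.subst (MvPowerSeries.X 1 : MvPowerSeries (Fin 2) R)) ^ 2 - 1) *
            (MvPowerSeries.C W.a₁ * W.formalChordZ + MvPowerSeries.C W.a₂ * W.formalChordZ ^ 2 +
            2 * MvPowerSeries.C W.a₃ * (W.formalSlope * W.formalChordZ + W.formalIntercept) +
        2 * MvPowerSeries.C W.a₄ * W.formalChordZ * (W.formalSlope * W.formalChordZ +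
            W.formalIntercept) + 3 * MvPowerSeries.C W.a₆ * (W.formalSlope * W.formalChordZ +
            W.formalIntercept) ^ 2 - 1) * δ (MvPowerSeries.X 0 : MvPowerSeries (Fin 2) R) +
      (MvPowerSeries.C W.a₁ * (MvPowerSeries.X 0 : MvPowerSeries (Fin 2) R) +
          MvPowerSeries.C W.a₂ * (MvPowerSeries.X 0 : MvPowerSeries (Fin 2) R) ^ 2 + 2 *
          MvPowerSeries.C W.a₃ * (W.formalW.subst (MvPowerSeries.X 0 : MvPowerSeries (Fin 2) R)) +
        2 * MvPowerSeries.C W.a₄ * (MvPowerSeries.X 0 : MvPowerSeries (Fin 2) R) *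
            (W.formalW.subst (MvPowerSeries.X 0 : MvPowerSeries (Fin 2) R)) + 3 *
            MvPowerSeries.C W.a₆ *
            (W.formalW.subst (MvPowerSeries.X 0 : MvPowerSeries (Fin 2) R)) ^ 2 - 1) *
            (MvPowerSeries.C W.a₁ * W.formalChordZ + MvPowerSeries.C W.a₂ * W.formalChordZ ^ 2 +
            2 * MvPowerSeries.C W.a₃ * (W.formalSlope * W.formalChordZ + W.formalIntercept) +
        2 * MvPowerSeries.C W.a₄ * W.formalChordZ * (W.formalSlope * W.formalChordZ +
            W.formalIntercept) + 3 * MvPowerSeries.C W.a₆ * (W.formalSlope * W.formalChordZ +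
            W.formalIntercept) ^ 2 - 1) * δ (MvPowerSeries.X 1 : MvPowerSeries (Fin 2) R) +
      (MvPowerSeries.C W.a₁ * (MvPowerSeries.X 0 : MvPowerSeries (Fin 2) R) +
          MvPowerSeries.C W.a₂ * (MvPowerSeries.X 0 : MvPowerSeries (Fin 2) R) ^ 2 + 2 *
          MvPowerSeries.C W.a₃ * (W.formalW.subst (MvPowerSeries.X 0 : MvPowerSeries (Fin 2) R)) +
        2 * MvPowerSeries.C W.a₄ * (MvPowerSeries.X 0 : MvPowerSeries (Fin 2) R) *
            (W.formalW.subst (MvPowerSeries.X 0 : MvPowerSeries (Fin 2) R)) + 3 *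
            MvPowerSeries.C W.a₆ *
            (W.formalW.subst (MvPowerSeries.X 0 : MvPowerSeries (Fin 2) R)) ^ 2 - 1) *
            (MvPowerSeries.C W.a₁ * (MvPowerSeries.X 1 : MvPowerSeries (Fin 2) R) +
            MvPowerSeries.C W.a₂ * (MvPowerSeries.X 1 : MvPowerSeries (Fin 2) R) ^ 2 + 2 *
            MvPowerSeries.C W.a₃ * (W.formalW.subst (MvPowerSeries.X 1 : MvPowerSeries (Fin 2) R)) +
        2 * MvPowerSeries.C W.a₄ * (MvPowerSeries.X 1 : MvPowerSeries (Fin 2) R) *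
            (W.formalW.subst (MvPowerSeries.X 1 : MvPowerSeries (Fin 2) R)) + 3 *
            MvPowerSeries.C W.a₆ *
            (W.formalW.subst (MvPowerSeries.X 1 : MvPowerSeries (Fin 2) R)) ^ 2 - 1) *
            δ W.formalChordZ = 0 := by
  -- the three differentiated incidences
  have h₁ := W.chord_incidence_deriv δ (ζ := (MvPowerSeries.X 0 : MvPowerSeries (Fin 2) R))
    (by rw [W.formalSlope_mul_X_zero_add_formalIntercept]; exact W.curveCubic_formalW_subst_X 0)
  have h₂ := W.chord_incidence_deriv δ (ζ := (MvPowerSeries.X 1 : MvPowerSeries (Fin 2) R))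
    (by rw [W.formalSlope_mul_X_one_add_formalIntercept]; exact W.curveCubic_formalW_subst_X 1)
  have h₃ := W.chord_incidence_deriv δ W.curveCubic_formalChordZ
  rw [W.formalSlope_mul_X_zero_add_formalIntercept] at h₁
  rw [W.formalSlope_mul_X_one_add_formalIntercept] at h₂
  have h₁' : W.formalChordDenom * ((MvPowerSeries.X 0 : MvPowerSeries (Fin 2) R) -
      (MvPowerSeries.X 1 : MvPowerSeries (Fin 2) R)) *
      ((MvPowerSeries.X 0 : MvPowerSeries (Fin 2) R) - W.formalChordZ) *
      δ (MvPowerSeries.X 0 : MvPowerSeries (Fin 2) R) +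
      (MvPowerSeries.C W.a₁ * (MvPowerSeries.X 0 : MvPowerSeries (Fin 2) R) +
          MvPowerSeries.C W.a₂ * (MvPowerSeries.X 0 : MvPowerSeries (Fin 2) R) ^ 2 + 2 *
          MvPowerSeries.C W.a₃ * (W.formalW.subst (MvPowerSeries.X 0 : MvPowerSeries (Fin 2) R)) +
        2 * MvPowerSeries.C W.a₄ * (MvPowerSeries.X 0 : MvPowerSeries (Fin 2) R) *
            (W.formalW.subst (MvPowerSeries.X 0 : MvPowerSeries (Fin 2) R)) + 3 *
            MvPowerSeries.C W.a₆ *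
            (W.formalW.subst (MvPowerSeries.X 0 : MvPowerSeries (Fin 2) R)) ^ 2 - 1) *
            ((MvPowerSeries.X 0 : MvPowerSeries (Fin 2) R) * δ W.formalSlope +
            δ W.formalIntercept) = 0 := by
    linear_combination h₁
  have h₂' : W.formalChordDenom * ((MvPowerSeries.X 1 : MvPowerSeries (Fin 2) R) -
      (MvPowerSeries.X 0 : MvPowerSeries (Fin 2) R)) *
      ((MvPowerSeries.X 1 : MvPowerSeries (Fin 2) R) - W.formalChordZ) *
      δ (MvPowerSeries.X 1 : MvPowerSeries (Fin 2) R) +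
      (MvPowerSeries.C W.a₁ * (MvPowerSeries.X 1 : MvPowerSeries (Fin 2) R) +
          MvPowerSeries.C W.a₂ * (MvPowerSeries.X 1 : MvPowerSeries (Fin 2) R) ^ 2 + 2 *
          MvPowerSeries.C W.a₃ * (W.formalW.subst (MvPowerSeries.X 1 : MvPowerSeries (Fin 2) R)) +
        2 * MvPowerSeries.C W.a₄ * (MvPowerSeries.X 1 : MvPowerSeries (Fin 2) R) *
            (W.formalW.subst (MvPowerSeries.X 1 : MvPowerSeries (Fin 2) R)) + 3 *
            MvPowerSeries.C W.a₆ *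
            (W.formalW.subst (MvPowerSeries.X 1 : MvPowerSeries (Fin 2) R)) ^ 2 - 1) *
            ((MvPowerSeries.X 1 : MvPowerSeries (Fin 2) R) * δ W.formalSlope +
            δ W.formalIntercept) = 0 := by
    linear_combination h₂
  have h₃' : W.formalChordDenom * (W.formalChordZ -
      (MvPowerSeries.X 0 : MvPowerSeries (Fin 2) R)) * (W.formalChordZ -
      (MvPowerSeries.X 1 : MvPowerSeries (Fin 2) R)) * δ W.formalChordZ +
      (MvPowerSeries.C W.a₁ * W.formalChordZ + MvPowerSeries.C W.a₂ * W.formalChordZ ^ 2 + 2 *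
          MvPowerSeries.C W.a₃ * (W.formalSlope * W.formalChordZ + W.formalIntercept) +
        2 * MvPowerSeries.C W.a₄ * W.formalChordZ * (W.formalSlope * W.formalChordZ +
            W.formalIntercept) + 3 * MvPowerSeries.C W.a₆ * (W.formalSlope * W.formalChordZ +
            W.formalIntercept) ^ 2 - 1) *
        (W.formalChordZ * δ W.formalSlope + δ W.formalIntercept) = 0 := by
    linear_combination h₃
  have key := abel_combination h₁' h₂' h₃'
  have hV : ((MvPowerSeries.X 0 : MvPowerSeries (Fin 2) R) -
      (MvPowerSeries.X 1 : MvPowerSeries (Fin 2) R)) *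
      ((MvPowerSeries.X 0 : MvPowerSeries (Fin 2) R) - W.formalChordZ) *
      ((MvPowerSeries.X 1 : MvPowerSeries (Fin 2) R) - W.formalChordZ) ≠ 0 :=
    mul_ne_zero (mul_ne_zero X_zero_sub_X_one_ne_zero (W.X_sub_formalChordZ_ne_zero 0 1 (by decide)))
      (W.X_sub_formalChordZ_ne_zero 1 0 (by decide))
  exact (mul_eq_zero.mp key).resolve_left (mul_ne_zero W.formalChordDenom_ne_zero hV)

/-- **`Γ₃ = -Γ₁ · ∂z₃/∂z₁`** and **`Γ₃ = -Γ₂ · ∂z₃/∂z₂`** (Abel's relation for `δ = ∂/∂zᵢ`):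
`ω(z₃, w₃) ∂ᵢz₃ = -ω(zᵢ)` for the third intersection of the chord. [Silverman AEC III.5.1] [folklore] -/
theorem Gamma_formalChordZ_eq (i : Fin 2) :
    (MvPowerSeries.C W.a₁ * W.formalChordZ + MvPowerSeries.C W.a₂ * W.formalChordZ ^ 2 + 2 *
        MvPowerSeries.C W.a₃ * (W.formalSlope * W.formalChordZ + W.formalIntercept) +
        2 * MvPowerSeries.C W.a₄ * W.formalChordZ * (W.formalSlope * W.formalChordZ +
            W.formalIntercept) + 3 * MvPowerSeries.C W.a₆ * (W.formalSlope * W.formalChordZ +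
            W.formalIntercept) ^ 2 - 1) =
      -(MvPowerSeries.C W.a₁ * ((MvPowerSeries.X i : MvPowerSeries (Fin 2) R)) +
          MvPowerSeries.C W.a₂ * ((MvPowerSeries.X i : MvPowerSeries (Fin 2) R)) ^ 2 + 2 *
          MvPowerSeries.C W.a₃ * (W.formalW.subst (MvPowerSeries.X i : MvPowerSeries (Fin 2) R)) +
        2 * MvPowerSeries.C W.a₄ * ((MvPowerSeries.X i : MvPowerSeries (Fin 2) R)) *
            (W.formalW.subst (MvPowerSeries.X i : MvPowerSeries (Fin 2) R)) + 3 *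
            MvPowerSeries.C W.a₆ *
            (W.formalW.subst (MvPowerSeries.X i : MvPowerSeries (Fin 2) R)) ^ 2 - 1) *
        MvPowerSeries.pderiv i W.formalChordZ := by
  classical
  have h := W.abel_relation (MvPowerSeries.pderiv i)
  rw [MvPowerSeries.pderiv_X, MvPowerSeries.pderiv_X] at h
  have hw : ∀ j : Fin 2,
      MvPowerSeries.constantCoeff (W.formalW.subst (MvPowerSeries.X j : MvPowerSeries (Fin 2) R)) =
      0 :=
    fun j =>
      constantCoeff_powerSeries_subst_eq_zero (MvPowerSeries.constantCoeff_X j) W.constantCoeff_formalW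
  have hΓ : ∀ j : Fin 2, (MvPowerSeries.C W.a₁ * ((MvPowerSeries.X j : MvPowerSeries (Fin 2) R)) +
      MvPowerSeries.C W.a₂ * ((MvPowerSeries.X j : MvPowerSeries (Fin 2) R)) ^ 2 + 2 *
      MvPowerSeries.C W.a₃ * (W.formalW.subst (MvPowerSeries.X j : MvPowerSeries (Fin 2) R)) +
        2 * MvPowerSeries.C W.a₄ * ((MvPowerSeries.X j : MvPowerSeries (Fin 2) R)) *
            (W.formalW.subst (MvPowerSeries.X j : MvPowerSeries (Fin 2) R)) + 3 *
            MvPowerSeries.C W.a₆ *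
            (W.formalW.subst (MvPowerSeries.X j : MvPowerSeries (Fin 2) R)) ^ 2 - 1) ≠ 0 := by
    intro j hj
    have := congrArg MvPowerSeries.constantCoeff hj
    rw [W.constantCoeff_Gamma (MvPowerSeries.constantCoeff_X j) (hw j), map_zero] at this
    norm_num at this
  fin_cases i
  · simp only [Fin.zero_eta, Fin.isValue, ↓reduceIte, mul_one, one_ne_zero, mul_zero,
      add_zero] at h ⊢
    have h' : (MvPowerSeries.C W.a₁ * (MvPowerSeries.X 1 : MvPowerSeries (Fin 2) R) +
        MvPowerSeries.C W.a₂ * (MvPowerSeries.X 1 : MvPowerSeries (Fin 2) R) ^ 2 + 2 *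
        MvPowerSeries.C W.a₃ * (W.formalW.subst (MvPowerSeries.X 1 : MvPowerSeries (Fin 2) R)) +
        2 * MvPowerSeries.C W.a₄ * (MvPowerSeries.X 1 : MvPowerSeries (Fin 2) R) *
            (W.formalW.subst (MvPowerSeries.X 1 : MvPowerSeries (Fin 2) R)) + 3 *
            MvPowerSeries.C W.a₆ *
            (W.formalW.subst (MvPowerSeries.X 1 : MvPowerSeries (Fin 2) R)) ^ 2 - 1) *
        ((MvPowerSeries.C W.a₁ * W.formalChordZ + MvPowerSeries.C W.a₂ * W.formalChordZ ^ 2 + 2 *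
            MvPowerSeries.C W.a₃ * (W.formalSlope * W.formalChordZ + W.formalIntercept) +
        2 * MvPowerSeries.C W.a₄ * W.formalChordZ * (W.formalSlope * W.formalChordZ +
            W.formalIntercept) + 3 * MvPowerSeries.C W.a₆ * (W.formalSlope * W.formalChordZ +
            W.formalIntercept) ^ 2 - 1) +
          (MvPowerSeries.C W.a₁ * (MvPowerSeries.X 0 : MvPowerSeries (Fin 2) R) +
              MvPowerSeries.C W.a₂ * (MvPowerSeries.X 0 : MvPowerSeries (Fin 2) R) ^ 2 + 2 *
              MvPowerSeries.C W.a₃ *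
              (W.formalW.subst (MvPowerSeries.X 0 : MvPowerSeries (Fin 2) R)) +
        2 * MvPowerSeries.C W.a₄ * (MvPowerSeries.X 0 : MvPowerSeries (Fin 2) R) *
            (W.formalW.subst (MvPowerSeries.X 0 : MvPowerSeries (Fin 2) R)) + 3 *
            MvPowerSeries.C W.a₆ *
            (W.formalW.subst (MvPowerSeries.X 0 : MvPowerSeries (Fin 2) R)) ^ 2 - 1) *
            MvPowerSeries.pderiv 0 W.formalChordZ) = 0 := by
      linear_combination h
    linear_combination (mul_eq_zero.mp h').resolve_left (hΓ 1)
  · simp only [Fin.mk_one, Fin.isValue, zero_ne_one, ↓reduceIte, mul_zero, zero_add, mul_one] at h ⊢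
    have h' : (MvPowerSeries.C W.a₁ * (MvPowerSeries.X 0 : MvPowerSeries (Fin 2) R) +
        MvPowerSeries.C W.a₂ * (MvPowerSeries.X 0 : MvPowerSeries (Fin 2) R) ^ 2 + 2 *
        MvPowerSeries.C W.a₃ * (W.formalW.subst (MvPowerSeries.X 0 : MvPowerSeries (Fin 2) R)) +
        2 * MvPowerSeries.C W.a₄ * (MvPowerSeries.X 0 : MvPowerSeries (Fin 2) R) *
            (W.formalW.subst (MvPowerSeries.X 0 : MvPowerSeries (Fin 2) R)) + 3 *
            MvPowerSeries.C W.a₆ *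
            (W.formalW.subst (MvPowerSeries.X 0 : MvPowerSeries (Fin 2) R)) ^ 2 - 1) *
        ((MvPowerSeries.C W.a₁ * W.formalChordZ + MvPowerSeries.C W.a₂ * W.formalChordZ ^ 2 + 2 *
            MvPowerSeries.C W.a₃ * (W.formalSlope * W.formalChordZ + W.formalIntercept) +
        2 * MvPowerSeries.C W.a₄ * W.formalChordZ * (W.formalSlope * W.formalChordZ +
            W.formalIntercept) + 3 * MvPowerSeries.C W.a₆ * (W.formalSlope * W.formalChordZ +
            W.formalIntercept) ^ 2 - 1) +
          (MvPowerSeries.C W.a₁ * (MvPowerSeries.X 1 : MvPowerSeries (Fin 2) R) +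
              MvPowerSeries.C W.a₂ * (MvPowerSeries.X 1 : MvPowerSeries (Fin 2) R) ^ 2 + 2 *
              MvPowerSeries.C W.a₃ *
              (W.formalW.subst (MvPowerSeries.X 1 : MvPowerSeries (Fin 2) R)) +
        2 * MvPowerSeries.C W.a₄ * (MvPowerSeries.X 1 : MvPowerSeries (Fin 2) R) *
            (W.formalW.subst (MvPowerSeries.X 1 : MvPowerSeries (Fin 2) R)) + 3 *
            MvPowerSeries.C W.a₆ *
            (W.formalW.subst (MvPowerSeries.X 1 : MvPowerSeries (Fin 2) R)) ^ 2 - 1) *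
            MvPowerSeries.pderiv 1 W.formalChordZ) = 0 := by
      linear_combination h
    linear_combination (mul_eq_zero.mp h').resolve_left (hΓ 0)

/-! ### The reflected point `F = i(z₃)`: `F u = -z₃`, `w(F) u = -w₃` -/

/-- `E(z₃) = u := 1 - a₁z₃ - a₃w₃` for the denominator `E = 1 - a₁z - a₃w(z)` of `i(z) = -z/E`.
[Silverman AEC IV.1 (p. 118)] [folklore] -/
theorem formalNegDenom_subst_formalChordZ :
    (1 - C W.a₁ * X - C W.a₃ * W.formalW).subst W.formalChordZ =
      1 - MvPowerSeries.C W.a₁ * W.formalChordZ - MvPowerSeries.C W.a₃ * (W.formalSlope *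
          W.formalChordZ + W.formalIntercept) := by
  have hg := W.hasSubst_formalChordZ
  have hC : ∀ a : R, (PowerSeries.C a).subst W.formalChordZ =
      MvPowerSeries.C a := fun a => PowerSeries.subst_C a
  rw [← W.formalW_subst_formalChordZ]
  simp only [← PowerSeries.coe_substAlgHom hg, map_sub, map_one, map_mul, PowerSeries.substAlgHom_X]
  simp only [PowerSeries.coe_substAlgHom hg, hC]

/-- `u · E⁻¹(z₃) = 1`. [folklore] -/
theorem formalNegDenom_subst_formalChordZ_mul_inv :
    (1 - MvPowerSeries.C W.a₁ * W.formalChordZ - MvPowerSeries.C W.a₃ * (W.formalSlope *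
        W.formalChordZ + W.formalIntercept)) *
        (invOfUnit (1 - C W.a₁ * X - C W.a₃ * W.formalW) 1).subst W.formalChordZ = 1 := by
  have hg := W.hasSubst_formalChordZ
  rw [← W.formalNegDenom_subst_formalChordZ, ← PowerSeries.coe_substAlgHom hg, ← map_mul,
    W.formalNegDenom_mul_invOfUnit, map_one]

/-- **`F · u = -z₃`**: `F = i(z₃) = -z₃/(1 - a₁z₃ - a₃w₃)`. [Silverman AEC IV.1 (p. 118,
`F(z₁, z₂) = i(z₃(z₁, z₂))`, `i(z) = x/(y + a₁x + a₃)` in the `z`-chart)] [folklore] -/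
theorem formalGroupLaw_mul_formalNegDenom :
    W.formalGroupLaw *
        (1 - MvPowerSeries.C W.a₁ * W.formalChordZ - MvPowerSeries.C W.a₃ * (W.formalSlope *
            W.formalChordZ + W.formalIntercept)) +
      W.formalChordZ = 0 := by
  have hg := W.hasSubst_formalChordZ
  have hF : W.formalGroupLaw =
      -(W.formalChordZ * (invOfUnit (1 - C W.a₁ * X - C W.a₃ *
          W.formalW) 1).subst W.formalChordZ) := by
    rw [formalGroupLaw, formalNeg_eq, ← PowerSeries.coe_substAlgHom hg, map_neg, map_mul,
      PowerSeries.substAlgHom_X]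
  rw [hF]
  linear_combination (-W.formalChordZ) * W.formalNegDenom_subst_formalChordZ_mul_inv

/-- **`w(F) · u = -w₃`**: the `w`-coordinate of the reflected point (`w(i(z)) = -w(z)/E(z)`,
`formalW_subst_formalNeg`, at `z = z₃`). [Silverman AEC IV.1 (p. 118)] [folklore] -/
theorem formalW_subst_formalGroupLaw_mul_formalNegDenom :
    W.formalW.subst W.formalGroupLaw *
        (1 - MvPowerSeries.C W.a₁ * W.formalChordZ - MvPowerSeries.C W.a₃ * (W.formalSlope *
            W.formalChordZ + W.formalIntercept)) +
      (W.formalSlope * W.formalChordZ + W.formalIntercept) = 0 := by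
  have hg := W.hasSubst_formalChordZ
  have hW : W.formalW.subst W.formalGroupLaw =
      -((W.formalSlope * W.formalChordZ + W.formalIntercept) *
        (invOfUnit (1 - C W.a₁ * X - C W.a₃ * W.formalW) 1).subst W.formalChordZ) := by
    rw [formalGroupLaw, ← PowerSeries.subst_comp_subst_apply W.hasSubst_formalNeg hg,
      W.formalW_subst_formalNeg, ← PowerSeries.coe_substAlgHom hg, map_neg, map_mul,
      PowerSeries.coe_substAlgHom hg, W.formalW_subst_formalChordZ]
  rw [hW]
  linear_combination (-(W.formalSlope * W.formalChordZ + W.formalIntercept)) *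
    W.formalNegDenom_subst_formalChordZ_mul_inv

omit [IsDomain R] in
/-- `u` is a unit (constant term `1`). [folklore] -/
theorem isUnit_formalNegDenom_formalChordZ :
    IsUnit (1 - MvPowerSeries.C W.a₁ * W.formalChordZ -
      MvPowerSeries.C W.a₃ * (W.formalSlope * W.formalChordZ + W.formalIntercept)) := by
  rw [MvPowerSeries.isUnit_iff_constantCoeff]
  simp [W.constantCoeff_formalChordZ, W.constantCoeff_formalIntercept]

/-! ### The main theorem: `η(zᵢ) · ∂ᵢF = η(F)` -/

/-- **The reflection step**: `∂ᵢF · Γ(z₃, w₃) + ∂ᵢz₃ · Γ(F, w(F)) = 0`, i.e. `[-1]^* ω = -ω` along the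
third intersection (`neg_step_identity` with the curve relation at `(z₃, w₃)`, its derivative, and
the derivative of `F u = -z₃`). [Silverman AEC III.5.2 (proof), IV.1 (p. 118)] [folklore] -/
theorem pderiv_formalGroupLaw_neg_step (i : Fin 2) :
    MvPowerSeries.pderiv i W.formalGroupLaw *
        (MvPowerSeries.C W.a₁ * W.formalChordZ + MvPowerSeries.C W.a₂ * W.formalChordZ ^ 2 + 2 *
            MvPowerSeries.C W.a₃ * (W.formalSlope * W.formalChordZ + W.formalIntercept) +
        2 * MvPowerSeries.C W.a₄ * W.formalChordZ * (W.formalSlope * W.formalChordZ +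
            W.formalIntercept) + 3 * MvPowerSeries.C W.a₆ * (W.formalSlope * W.formalChordZ +
            W.formalIntercept) ^ 2 - 1) +
      MvPowerSeries.pderiv i W.formalChordZ * (MvPowerSeries.C W.a₁ * W.formalGroupLaw +
          MvPowerSeries.C W.a₂ * W.formalGroupLaw ^ 2 + 2 * MvPowerSeries.C W.a₃ *
          (W.formalW.subst W.formalGroupLaw) +
        2 * MvPowerSeries.C W.a₄ * W.formalGroupLaw * (W.formalW.subst W.formalGroupLaw) + 3 *
            MvPowerSeries.C W.a₆ * (W.formalW.subst W.formalGroupLaw) ^ 2 - 1) = 0 := by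
  set δ := MvPowerSeries.pderiv (R := R) i with hδ
  set z := W.formalChordZ with hz
  set w := W.formalSlope * W.formalChordZ + W.formalIntercept with hw
  set F := W.formalGroupLaw with hF
  have hC := derivation_C_eq_zero δ
  -- the curve relation at `(z₃, w₃)` and its derivative
  have h0 := W.curveCubic_formalChordZ
  rw [← hz, ← hw] at h0
  have h1 := congrArg δ h0
  rw [map_zero, deriv_curveCubic δ (hC _) (hC _) (hC _) (hC _) (hC _)] at h1
  -- `F u = -z₃`, `w(F) u = -w₃`, and the derivative of the former
  have h3 := W.formalGroupLaw_mul_formalNegDenom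
  have h4 := W.formalW_subst_formalGroupLaw_mul_formalNegDenom
  rw [← hz, ← hw, ← hF] at h3 h4
  have h5 : δ (F * (1 - MvPowerSeries.C W.a₁ * z - MvPowerSeries.C W.a₃ * w) + z) = 0 := by rw [h3,
      map_zero]
  simp only [map_add, map_sub, Derivation.leibniz, Derivation.map_one_eq_zero, hC, smul_eq_mul,
    mul_zero, add_zero, zero_sub] at h5
  have h5' : δ F * (1 - MvPowerSeries.C W.a₁ * z - MvPowerSeries.C W.a₃ * w) + F *
      (-MvPowerSeries.C W.a₁ * δ z - MvPowerSeries.C W.a₃ * δ w) + δ z = 0 := by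
    linear_combination h5
  have key := neg_step_identity (MvPowerSeries.C W.a₁) (MvPowerSeries.C W.a₂)
      (MvPowerSeries.C W.a₃) (MvPowerSeries.C W.a₄) (MvPowerSeries.C W.a₆) z w (δ z) (δ w) F
    (W.formalW.subst F) (δ F) h0 h1 h3 h4 h5'
  have hu := W.isUnit_formalNegDenom_formalChordZ
  rw [← hz, ← hw] at hu
  exact (hu.pow 2).mul_right_eq_zero.mp key

/-- **The invariant differential is `F`-invariant** (Silverman AEC IV.4 / III.5.1 for the
chord–tangent law of AEC IV.1, over any domain and for every Weierstrass curve):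
`η(zᵢ) · ∂F/∂zᵢ = η(F(z₁, z₂))`, i.e. `ω(F(z₁, z₂)) · F_{zᵢ}(z₁, z₂) = ω(zᵢ)` with `ω = dz/η(z)`,
`η = formalEta = 1 - f_w(z, w(z))`. Proof: Abel's relation `Γ₃ = -Γᵢ ∂ᵢz₃` for the chord and the
reflection step `Γ(F, w(F)) ∂ᵢz₃ = -Γ₃ ∂ᵢF`, with `∂ᵢz₃` a unit and `η(g) = -Γ(g, w(g))`.
[Silverman AEC IV.4 (`ω ∘ F = ω`), III.5.1, IV.1] [cite: SilvermanAEC2009, III.5.1] -/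
theorem formalEta_subst_X_mul_pderiv_formalGroupLaw (i : Fin 2) :
    W.formalEta.subst (MvPowerSeries.X i : MvPowerSeries (Fin 2) R) *
        MvPowerSeries.pderiv i W.formalGroupLaw =
      W.formalEta.subst W.formalGroupLaw := by
  have hA := W.Gamma_formalChordZ_eq i
  have hB := W.pderiv_formalGroupLaw_neg_step i
  rw [hA] at hB
  have hC : MvPowerSeries.pderiv i W.formalChordZ *
      ((MvPowerSeries.C W.a₁ * W.formalGroupLaw + MvPowerSeries.C W.a₂ * W.formalGroupLaw ^ 2 + 2 *
          MvPowerSeries.C W.a₃ * (W.formalW.subst W.formalGroupLaw) +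
        2 * MvPowerSeries.C W.a₄ * W.formalGroupLaw * (W.formalW.subst W.formalGroupLaw) + 3 *
            MvPowerSeries.C W.a₆ * (W.formalW.subst W.formalGroupLaw) ^ 2 - 1) -
        (MvPowerSeries.C W.a₁ * ((MvPowerSeries.X i : MvPowerSeries (Fin 2) R)) +
            MvPowerSeries.C W.a₂ * ((MvPowerSeries.X i : MvPowerSeries (Fin 2) R)) ^ 2 + 2 *
            MvPowerSeries.C W.a₃ * (W.formalW.subst (MvPowerSeries.X i : MvPowerSeries (Fin 2) R)) +
        2 * MvPowerSeries.C W.a₄ * ((MvPowerSeries.X i : MvPowerSeries (Fin 2) R)) *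
            (W.formalW.subst (MvPowerSeries.X i : MvPowerSeries (Fin 2) R)) + 3 *
            MvPowerSeries.C W.a₆ *
            (W.formalW.subst (MvPowerSeries.X i : MvPowerSeries (Fin 2) R)) ^ 2 - 1) *
          MvPowerSeries.pderiv i W.formalGroupLaw) = 0 := by
    linear_combination hB
  have hD := (W.isUnit_pderiv_formalChordZ i).mul_right_eq_zero.mp hC
  rw [W.formalEta_subst (PowerSeries.HasSubst.X i), W.formalEta_subst W.hasSubst_formalGroupLaw]
  linear_combination hD

/-- The same with `ω`: over a `ℚ`-algebra (where `formalOmega = ω/dz` lives),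
**`ω(F(z₁, z₂)) · ∂F/∂zᵢ = ω(zᵢ)`** — the defining property of an invariant differential
(AEC IV.4) for the curve's `ω = dx/(2y + a₁x + a₃)` and the chord–tangent law `F`.
[Silverman AEC IV.4 (Definition: `ω(F(T,S)) F_X(T,S) = ω(T)`), III.5.1] [cite: SilvermanAEC2009, III.5.1] -/
theorem formalOmega_subst_formalGroupLaw_mul_pderiv {A : Type*} [CommRing A] [IsDomain A] [Algebra ℚ A]
    (V : WeierstrassCurve A) (i : Fin 2) :
    V.formalOmega.subst V.formalGroupLaw * MvPowerSeries.pderiv i V.formalGroupLaw =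
      V.formalOmega.subst (MvPowerSeries.X i : MvPowerSeries (Fin 2) A) := by
  have hF := V.hasSubst_formalGroupLaw
  have hX : PowerSeries.HasSubst (MvPowerSeries.X i : MvPowerSeries (Fin 2) A) :=
    PowerSeries.HasSubst.X i
  -- `ω(g) η(g) = 1` for `g = F` and `g = zᵢ`
  have hωη : ∀ {g : MvPowerSeries (Fin 2) A} (hg : PowerSeries.HasSubst g),
      V.formalOmega.subst g * V.formalEta.subst g = 1 := fun hg => by
    rw [← PowerSeries.coe_substAlgHom hg, ← map_mul, V.formalOmega_mul_formalEta, map_one]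
  have h := V.formalEta_subst_X_mul_pderiv_formalGroupLaw i
  calc V.formalOmega.subst V.formalGroupLaw * MvPowerSeries.pderiv i V.formalGroupLaw
      = V.formalOmega.subst V.formalGroupLaw * MvPowerSeries.pderiv i V.formalGroupLaw *
          (V.formalOmega.subst (MvPowerSeries.X i) * V.formalEta.subst (MvPowerSeries.X i)) := by
        rw [hωη hX, mul_one]
    _ = V.formalOmega.subst (MvPowerSeries.X i) * V.formalOmega.subst V.formalGroupLaw *
          (V.formalEta.subst (MvPowerSeries.X i) *
              MvPowerSeries.pderiv i V.formalGroupLaw) := by ring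
    _ = V.formalOmega.subst (MvPowerSeries.X i) := by
        rw [h, mul_assoc, hωη hF, mul_one]

end Formal

end WeierstrassCurve
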